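import Literature.Computability.MetaComplexity.McKayMurrayWilliams2019.UniformStreaming
import Literature.Computability.Complexity.CNF
import Literature.Computability.Complexity.TM2PassThrough
import HarnessLib

/-!
# THEOREM F: the proved fragment of the summit's streaming form — SAT needs one-pass space `N / O(log N)`

THEOREM E (`SoloBlindStreamingCompleteness`) put the summit inside the typed one-pass model:
`PneNP ↔ ∀ k, SAT ∉ USTREAM (N^k + k) (N^k + k)`.  This file proves, unconditionally and in the
kernel, the part of that family of lower bounds which present technique reaches, and shows that
it is exactly the information-theoretic part:

* `card_lt_two_pow_of_fooling` — the **fooling-set bound** for the tree's one-pass model: if a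
  streaming algorithm deciding `L` runs in space `S` and `u : ι → {0,1}*` is a family of prefixes
  of inputs of length `N` that are pairwise separated by a common-length completion
  (`uᵢ ++ v ∈ L ↮ uⱼ ++ v ∈ L`), then `|ι| < 2^(S N + 1)` (the states reached on the `uᵢ` are
  pairwise distinct words of length `≤ S N`).  It needs no uniformity and no time bound, so it
  holds for `USTREAM S T` and for the non-uniform `STREAM S T` alike.
* `SATFool.*` — an explicit fooling family for `SAT` in the tree's CNF encoding: for `n = 2^k`
  variables `x_{2^k}, …, x_{2^{k+1}-1}` (all with `(k+1)`-bit indices, so that all code words below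
  have the same length) and `a : Fin n → Bool`, the prefix `U a` encodes the `n` unit clauses
  fixing `x_{2^k+i} = a i`, and the suffix `V j` encodes the clause `¬x_{2^k+j}`; the CNF
  `φ a j = U a ++ V j` is satisfiable iff `a j = false` (`satisfiable_phi_iff`), so the `2^n`
  prefixes are pairwise separated; every word has length `foolLen k = 2^k (8k + 36) + 8k + 38`.
* `two_pow_le_space_of_SAT_mem_USTREAM` / `…_STREAM`: `SAT ∈ USTREAM S T → ∀ k, 2^k ≤ S (foolLen k)`;
  hence (`SAT_not_mem_USTREAM_of_sublinear`, `SAT_not_mem_STREAM_of_sublinear`) `SAT` is in no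
  `USTREAM S T` / `STREAM S T` with `S N · (16 ⌊log₂ N⌋ + 74) < N` for all large `N` — whatever
  the update time `T` — and in particular (`SAT_not_mem_USTREAM_pow_zero`) the instance `k = 0`
  of THEOREM E's family holds.

READING (calibration, not a route).  In the `(space, time)` plane of the typed model the summit is
the conjunction over all `k` of `SAT ∉ USTREAM (N^k + k) (N^k + k)`; what is proved here is every
instance with space below `N / (16 log₂ N + 74)`, for ALL time bounds, by an argument that is
insensitive to update time and to uniformity — and by THEOREM E's buffering algorithm nothing of
this kind survives at space `N + O(1)`, where membership of `SAT` in `USTREAM` is governed by the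
time complexity of `SAT` alone.  There is no intermediate regime: the passage from the proved
region to the summit is entirely in the time coordinate.  For the sparse language `MCSP[s]` of
corridor B the same information threshold sits at space `Õ(s(log N))` (`SoloBlindSparseStreaming`),
immediately below the magnification threshold `poly(s(log N))` space AND time: hardness
magnification relocates the information threshold to scale `N^{o(1)}`, it does not create a
regime where time-insensitive arguments have purchase.

References: the fooling-set / crossing-sequence method is folklore (e.g. J. E. Hopcroft,
J. D. Ullman, *Introduction to Automata Theory, Languages, and Computation*, 1979, §3.4
(Myhill–Nerode); S. Arora, B. Barak, *Computational Complexity: A Modern Approach*, 2009,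
§13.1 (fooling sets in communication complexity)); the streaming model is that of D. M. McKay,
C. D. Murray, R. R. Williams, STOC 2019, §2.
-/

namespace Summit.PneNP.PneNP.Theorems.SoloBlind

open Computability
open Literature.Computability.Complexity Literature.Computability.MetaComplexity
open Literature.Computability.MetaComplexity.McKayMurrayWilliams2019

/-! ### Counting short words -/

/-- A finite set of words of length `≤ s` has fewer than `2^(s+1)` elements. [folklore] -/
theorem card_lt_two_pow_of_length_le (G : Finset (List Bool)) {s : ℕ}
    (h : ∀ w ∈ G, w.length ≤ s) : G.card < 2 ^ (s + 1) := by
  classical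
  have hsub : G ⊆ (Finset.range (s + 1)).biUnion
      (fun k => (Finset.univ : Finset (Fin k → Bool)).image List.ofFn) := by
    intro w hw
    refine Finset.mem_biUnion.2 ⟨w.length, Finset.mem_range.2 (Nat.lt_succ_of_le (h w hw)),
      Finset.mem_image.2 ⟨w.get, Finset.mem_univ _, List.ofFn_get w⟩⟩
  refine (Finset.card_le_card hsub).trans_lt ?_
  refine (Finset.card_biUnion_le).trans_lt ?_
  calc ∑ k ∈ Finset.range (s + 1), ((Finset.univ : Finset (Fin k → Bool)).image List.ofFn).card
      ≤ ∑ k ∈ Finset.range (s + 1), 2 ^ k := Finset.sum_le_sum fun k _ =>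
        Finset.card_image_le.trans (by simp)
    _ < 2 ^ (s + 1) := Nat.geomSum_lt le_rfl fun k hk => Finset.mem_range.1 hk

/-! ### The fooling-set bound for one-pass streaming algorithms -/

/-- Reading a concatenation: the state after `x ++ y` is the run on `y` from the state after `x`.
[folklore] -/
theorem reach_append (A : StreamingAlgorithm) (N : ℕ) (x y : List Bool) :
    reach A N (x ++ y) = A.runFrom N (reach A N x) y := by
  simp [reach, StreamingAlgorithm.runFrom, List.foldl_append]

/-- If two prefixes reach the same state, every common completion to length `N` is accepted on
both or on neither. [folklore] -/
theorem mem_iff_of_reach_eq {A : StreamingAlgorithm} {L : Language Bool} (hL : A.Decides L)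
    {N : ℕ} {u u' v : List Bool} (hu : (u ++ v).length = N) (hu' : (u' ++ v).length = N)
    (he : reach A N u = reach A N u') : (u ++ v ∈ L ↔ u' ++ v ∈ L) := by
  rw [← hL (u ++ v), ← hL (u' ++ v)]
  simp only [StreamingAlgorithm.Accepts, finalState_eq_reach, hu, hu', reach_append, he]

/-- **Fooling-set bound.** If a one-pass streaming algorithm decides `L` in space `S` (on runs)
and the prefixes `u i` (`i : ι`) of inputs of length `N` are pairwise separated by a completion of
the right length, then `|ι| < 2^(S N + 1)`: the reached states `reach A N (u i)` are pairwise
distinct words of length `≤ S N`. No uniformity or time bound is used.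
[cite: AroraBarak2009, §13.1 (fooling sets); folklore (Myhill–Nerode)] -/
theorem card_lt_two_pow_of_fooling {A : StreamingAlgorithm} {S : ℕ → ℕ} {L : Language Bool}
    (hS : RunsInSpace A S) (hL : A.Decides L) {N : ℕ} {ι : Type*} [Fintype ι]
    (u : ι → List Bool) (hlen : ∀ i, (u i).length ≤ N)
    (hsep : ∀ i j, i ≠ j → ∃ v : List Bool, (u i ++ v).length = N ∧ (u j ++ v).length = N ∧
      ¬ (u i ++ v ∈ L ↔ u j ++ v ∈ L)) :
    Fintype.card ι < 2 ^ (S N + 1) := by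
  classical
  have hinj : Function.Injective fun i => reach A N (u i) := by
    intro i j hij
    by_contra hne
    obtain ⟨v, hi, hj, hv⟩ := hsep i j hne
    exact hv (mem_iff_of_reach_eq hL hi hj hij)
  have hcard : (Finset.univ.image fun i => reach A N (u i)).card = Fintype.card ι := by
    rw [Finset.card_image_of_injective _ hinj, Finset.card_univ]
  rw [← hcard]
  refine card_lt_two_pow_of_length_le _ fun w hw => ?_
  obtain ⟨i, -, rfl⟩ := Finset.mem_image.1 hw
  exact hS N (u i) (hlen i)

/-- The same bound for a language in `USTREAM S T` (any `T`). [folklore] -/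
theorem card_lt_two_pow_of_fooling_USTREAM {S T : ℕ → ℕ} {L : Language Bool}
    (hmem : L ∈ USTREAM S T) {N : ℕ} {ι : Type*} [Fintype ι]
    (u : ι → List Bool) (hlen : ∀ i, (u i).length ≤ N)
    (hsep : ∀ i j, i ≠ j → ∃ v : List Bool, (u i ++ v).length = N ∧ (u j ++ v).length = N ∧
      ¬ (u i ++ v ∈ L ↔ u j ++ v ∈ L)) :
    Fintype.card ι < 2 ^ (S N + 1) := by
  obtain ⟨A, -, hS, -, -, hD⟩ := hmem
  exact card_lt_two_pow_of_fooling hS hD u hlen hsep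

/-- The same bound for a language in the non-uniform class `STREAM S T` (any `T`). [folklore] -/
theorem card_lt_two_pow_of_fooling_STREAM {S T : ℕ → ℕ} {L : Language Bool}
    (hmem : L ∈ STREAM S T) {N : ℕ} {ι : Type*} [Fintype ι]
    (u : ι → List Bool) (hlen : ∀ i, (u i).length ≤ N)
    (hsep : ∀ i j, i ≠ j → ∃ v : List Bool, (u i ++ v).length = N ∧ (u j ++ v).length = N ∧
      ¬ (u i ++ v ∈ L ↔ u j ++ v ∈ L)) :
    Fintype.card ι < 2 ^ (S N + 1) := by
  obtain ⟨A, hS, -, hD⟩ := hmem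
  exact card_lt_two_pow_of_fooling (runsInSpace_of_hasSpace hS) hD u hlen hsep

/-! ### The fooling family for `SAT` -/

namespace SATFool

/-- The variable `x_{2^k + i}` (so that all variable indices have `k + 1` binary digits). [folklore] -/
def var (k : ℕ) (i : Fin (2 ^ k)) : ℕ := 2 ^ k + i

/-- The `2^k` unit clauses fixing `x_{2^k+i} = a i`. [folklore] -/
def pre (k : ℕ) (a : Fin (2 ^ k) → Bool) : CNF ℕ :=
  List.ofFn fun i => [(var k i, a i)]

/-- The test clause `¬ x_{2^k+j}`. [folklore] -/
def lastClause (k : ℕ) (j : Fin (2 ^ k)) : Clause ℕ := [(var k j, false)]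

/-- The CNF `φ a j`: the unit clauses of `a` followed by `¬ x_{2^k+j}`. [folklore] -/
def phi (k : ℕ) (a : Fin (2 ^ k) → Bool) (j : Fin (2 ^ k)) : CNF ℕ :=
  pre k a ++ [lastClause k j]

/-- Distinct indices give distinct variables. [folklore] -/
theorem var_injective (k : ℕ) : Function.Injective (var k) := by
  intro i j h
  simp only [var, Nat.add_left_cancel_iff] at h
  exact Fin.ext h

open Classical in
/-- The assignment reading `a` on the variables `x_{2^k+i}` (and `false` elsewhere). [folklore] -/
noncomputable def assign (k : ℕ) (a : Fin (2 ^ k) → Bool) : ℕ → Bool := fun x =>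
  if h : ∃ i, var k i = x then a h.choose else false

/-- `assign a` reads `a i` on `x_{2^k+i}`. [folklore] -/
theorem assign_var (k : ℕ) (a : Fin (2 ^ k) → Bool) (i : Fin (2 ^ k)) :
    assign k a (var k i) = a i := by
  have hex : ∃ i', var k i' = var k i := ⟨i, rfl⟩
  unfold assign
  rw [dif_pos hex]
  exact congrArg a (var_injective k hex.choose_spec)

/-- `φ a j` is satisfiable iff `a j = false`. [folklore] -/
theorem satisfiable_phi_iff (k : ℕ) (a : Fin (2 ^ k) → Bool) (j : Fin (2 ^ k)) :
    (phi k a j).Satisfiable ↔ a j = false := by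
  constructor
  · rintro ⟨σ, hσ⟩
    rw [CNF.eval_eq_true_iff] at hσ
    have h1 : σ (var k j) = a j := by
      have := hσ [(var k j, a j)] (by
        simp only [phi, pre, lastClause, List.mem_append, List.mem_ofFn, List.mem_singleton]
        exact Or.inl ⟨j, rfl⟩)
      simpa [Clause.eval, Literal.eval] using this
    have h2 : σ (var k j) = false := by
      have := hσ (lastClause k j) (by simp [phi])
      simpa [lastClause, Clause.eval, Literal.eval] using this
    rw [← h1, h2]
  · intro hj
    refine ⟨assign k a, ?_⟩
    rw [CNF.eval_eq_true_iff]
    intro c hc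
    simp only [phi, pre, lastClause, List.mem_append, List.mem_ofFn, List.mem_singleton] at hc
    rcases hc with ⟨i, rfl⟩ | rfl
    · simp [Clause.eval, Literal.eval, assign_var]
    · simp [Clause.eval, Literal.eval, assign_var, hj]

/-! #### The code words -/

/-- The block of a clause inside the code of a CNF: its code with doubled bits, then the
separator `01`. [folklore] -/
def blk (c : Clause ℕ) : List Bool :=
  ((encodingClause.encode c).flatMap fun b => [b, b]) ++ [false, true]

/-- The prefix word of `a`: header (number of clauses `2^k + 1` in unary) and the blocks of the
unit clauses. [folklore] -/
def U (k : ℕ) (a : Fin (2 ^ k) → Bool) : List Bool :=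
  boolPair (unaryEncodeNat (2 ^ k + 1)) ((pre k a).flatMap blk)

/-- The suffix word of `j`: the block of the test clause. [folklore] -/
def V (k : ℕ) (j : Fin (2 ^ k)) : List Bool := blk (lastClause k j)

/-- The nested-pair code of a list is the concatenation of the blocks. [folklore] -/
theorem foldr_boolPair_eq_flatMap (l : CNF ℕ) :
    l.foldr (fun c acc => boolPair (encodingClause.encode c) acc) [] = l.flatMap blk := by
  induction l with
  | nil => rfl
  | cons c l ih =>
    rw [List.foldr_cons, ih, List.flatMap_cons]
    simp [blk, boolPair, List.append_assoc]

/-- The code of `φ a j` is `U a ++ V j`. [folklore] -/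
theorem encode_phi (k : ℕ) (a : Fin (2 ^ k) → Bool) (j : Fin (2 ^ k)) :
    encodingCNF.encode (phi k a j) = U k a ++ V k j := by
  show boolPair (unaryEncodeNat (phi k a j).length)
      ((phi k a j).foldr (fun c acc => boolPair (encodingClause.encode c) acc) []) = _
  rw [foldr_boolPair_eq_flatMap]
  have hlen : (phi k a j).length = 2 ^ k + 1 := by simp [phi, pre]
  rw [hlen]
  simp [phi, U, V, boolPair, List.flatMap_append, List.append_assoc]

/-- Unary codes have the obvious length. [folklore] -/
private theorem length_unaryEncodeNat (n : ℕ) : (unaryEncodeNat n).length = n := by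
  induction n with
  | zero => rfl
  | succ n ih => simp [unaryEncodeNat, ih]

/-- Variable indices have `k + 1` binary digits. [folklore] -/
theorem length_encodeNat_var (k : ℕ) (i : Fin (2 ^ k)) :
    (encodeNat (var k i)).length = k + 1 := by
  rw [TM2Pass.length_encodeNat_eq_size]
  apply le_antisymm
  · exact Nat.size_le.2 (by rw [pow_succ]; unfold var; omega)
  · exact Nat.lt_size.2 (by unfold var; omega)

/-- Every block of a unit clause on one of our variables has length `8k + 34`. [folklore] -/
theorem length_blk_unit (k : ℕ) (i : Fin (2 ^ k)) (b : Bool) :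
    (blk [(var k i, b)]).length = 8 * k + 34 := by
  have hlit : (encodingLiteral.encode (var k i, b)).length = 2 * (k + 1) + 3 := by
    show (boolPair (encodeNat (var k i)) (encodeBool b)).length = _
    rw [length_boolPair, length_encodeNat_var]
    simp [encodeBool]
  have hcl : (encodingClause.encode [(var k i, b)]).length = 4 * k + 16 := by
    show (boolPair (unaryEncodeNat 1) ([(var k i, b)].foldr
      (fun l acc => boolPair (encodingLiteral.encode l) acc) [])).length = _
    simp only [List.foldr_cons, List.foldr_nil, length_boolPair, length_unaryEncodeNat, hlit,
      List.length_nil]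
    omega
  simp only [blk, List.length_append, List.length_flatMap, List.map_const', List.sum_replicate,
    smul_eq_mul, hcl, List.length_cons, List.length_nil]
  omega

/-- Total length of the blocks of the unit clauses. [folklore] -/
theorem length_flatMap_blk_pre (k : ℕ) (a : Fin (2 ^ k) → Bool) :
    ((pre k a).flatMap blk).length = 2 ^ k * (8 * k + 34) := by
  rw [List.length_flatMap]
  have : (pre k a).map (fun c => (blk c).length) = (pre k a).map fun _ => 8 * k + 34 := by
    apply List.map_congr_left
    intro c hc
    simp only [pre, List.mem_ofFn] at hc
    obtain ⟨i, rfl⟩ := hc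
    exact length_blk_unit k i (a i)
  rw [this, List.map_const', List.sum_replicate, smul_eq_mul]
  simp [pre]

/-- The common length of the words `U a ++ V j`. [folklore] -/
def foolLen (k : ℕ) : ℕ := 2 * (2 ^ k + 1) + 2 + 2 ^ k * (8 * k + 34) + (8 * k + 34)

/-- Length of the prefix word. [folklore] -/
theorem length_U (k : ℕ) (a : Fin (2 ^ k) → Bool) :
    (U k a).length = 2 * (2 ^ k + 1) + 2 + 2 ^ k * (8 * k + 34) := by
  rw [U, length_boolPair, length_unaryEncodeNat, length_flatMap_blk_pre]

/-- Length of the suffix word. [folklore] -/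
theorem length_V (k : ℕ) (j : Fin (2 ^ k)) : (V k j).length = 8 * k + 34 :=
  length_blk_unit k j false

/-- All fooling words have length `foolLen k`. [folklore] -/
theorem length_U_append_V (k : ℕ) (a : Fin (2 ^ k) → Bool) (j : Fin (2 ^ k)) :
    (U k a ++ V k j).length = foolLen k := by
  rw [List.length_append, length_U, length_V, foolLen]

/-- `2^k ≤ foolLen k`. [folklore] -/
theorem two_pow_le_foolLen (k : ℕ) : 2 ^ k ≤ foolLen k := by unfold foolLen; omega

/-- `foolLen k ≤ 2^k (16k + 74)`. [folklore] -/
theorem foolLen_le (k : ℕ) : foolLen k ≤ 2 ^ k * (16 * k + 74) := by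
  have h1 : 1 ≤ 2 ^ k := Nat.one_le_two_pow
  have e : 2 ^ k * (16 * k + 74) = 2 ^ k * (8 * k + 34) + 2 * 2 ^ k + 2 ^ k * (8 * k + 38) := by
    ring
  have h2 : 8 * k + 38 ≤ 2 ^ k * (8 * k + 38) := Nat.le_mul_of_pos_left _ (by omega)
  unfold foolLen
  omega

/-- Membership of the fooling words in `SAT`. [folklore] -/
theorem U_append_V_mem_SAT_iff (k : ℕ) (a : Fin (2 ^ k) → Bool) (j : Fin (2 ^ k)) :
    U k a ++ V k j ∈ SAT ↔ a j = false := by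
  rw [← encode_phi, mem_SAT_iff, satisfiable_phi_iff]

/-- The prefixes `U a` are pairwise separated at length `foolLen k`. [folklore] -/
theorem separated (k : ℕ) (a a' : Fin (2 ^ k) → Bool) (h : a ≠ a') :
    ∃ v : List Bool, (U k a ++ v).length = foolLen k ∧ (U k a' ++ v).length = foolLen k ∧
      ¬ (U k a ++ v ∈ SAT ↔ U k a' ++ v ∈ SAT) := by
  obtain ⟨j, hj⟩ := Function.ne_iff.1 h
  refine ⟨V k j, length_U_append_V k a j, length_U_append_V k a' j, ?_⟩
  rw [U_append_V_mem_SAT_iff, U_append_V_mem_SAT_iff]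
  cases ha : a j <;> cases ha' : a' j <;> simp_all

end SATFool

/-! ### THEOREM F: the space lower bound for `SAT` -/

open SATFool

/-- **Space lower bound at the fooling lengths.** Any one-pass streaming algorithm deciding `SAT`
in space `S` on runs has `2^k ≤ S (foolLen k)` for every `k`. [folklore (fooling set)] -/
theorem two_pow_le_space_of_decides_SAT {A : StreamingAlgorithm} {S : ℕ → ℕ}
    (hS : RunsInSpace A S) (hD : A.Decides SAT) (k : ℕ) : 2 ^ k ≤ S (foolLen k) := by
  have h := card_lt_two_pow_of_fooling hS hD (N := foolLen k) (U k)
    (fun a => by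
      have := length_U_append_V k a ⟨0, Nat.two_pow_pos k⟩
      rw [List.length_append] at this; omega)
    (fun a a' h => separated k a a' h)
  simp only [Fintype.card_fun, Fintype.card_fin, Fintype.card_bool] at h
  have := (Nat.pow_lt_pow_iff_right (by norm_num : 1 < 2)).1 h
  omega

/-- **THEOREM F (uniform class).** `SAT ∈ USTREAM S T → ∀ k, 2^k ≤ S (foolLen k)`, for every
update-time bound `T`. [folklore (fooling set)] -/
theorem two_pow_le_space_of_SAT_mem_USTREAM {S T : ℕ → ℕ} (hmem : SAT ∈ USTREAM S T) (k : ℕ) :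
    2 ^ k ≤ S (foolLen k) := by
  obtain ⟨A, -, hS, -, -, hD⟩ := hmem
  exact two_pow_le_space_of_decides_SAT hS hD k

/-- **THEOREM F (non-uniform class).** `SAT ∈ STREAM S T → ∀ k, 2^k ≤ S (foolLen k)`. [folklore] -/
theorem two_pow_le_space_of_SAT_mem_STREAM {S T : ℕ → ℕ} (hmem : SAT ∈ STREAM S T) (k : ℕ) :
    2 ^ k ≤ S (foolLen k) := by
  obtain ⟨A, hS, -, hD⟩ := hmem
  exact two_pow_le_space_of_decides_SAT (runsInSpace_of_hasSpace hS) hD k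

/-- The asymptotic form: a space bound with `S N · (16 ⌊log₂ N⌋ + 74) < N` for all large `N` is
violated at some fooling length. [folklore] -/
theorem exists_foolLen_violation {S : ℕ → ℕ}
    (h : ∃ N₀, ∀ N ≥ N₀, S N * (16 * Nat.log 2 N + 74) < N) :
    ∃ k, S (foolLen k) < 2 ^ k := by
  obtain ⟨N₀, hN₀⟩ := h
  -- a fooling length beyond `N₀`
  obtain ⟨k, hk⟩ : ∃ k, N₀ ≤ 2 ^ k := ⟨N₀, Nat.lt_two_pow_self.le⟩
  refine ⟨k, ?_⟩
  have hN := hN₀ (foolLen k) (hk.trans (two_pow_le_foolLen k))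
  have hlog : k ≤ Nat.log 2 (foolLen k) :=
    Nat.le_log_of_pow_le (by norm_num) (two_pow_le_foolLen k)
  rcases Nat.lt_or_ge (S (foolLen k)) (2 ^ k) with hlt | hcon
  · exact hlt
  · exfalso
    have h1 : 2 ^ k * (16 * k + 74) ≤ S (foolLen k) * (16 * Nat.log 2 (foolLen k) + 74) :=
      Nat.mul_le_mul hcon (by omega)
    have h2 := foolLen_le k
    omega

/-- **THEOREM F, headline (uniform).** If `S N · (16 ⌊log₂ N⌋ + 74) < N` for all large `N`, then
`SAT ∉ USTREAM S T` for every `T`: one-pass algorithms for `SAT` need space `N / O(log N)`,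
whatever their update time. [folklore (fooling set)] -/
theorem SAT_not_mem_USTREAM_of_sublinear {S : ℕ → ℕ}
    (h : ∃ N₀, ∀ N ≥ N₀, S N * (16 * Nat.log 2 N + 74) < N) (T : ℕ → ℕ) :
    SAT ∉ USTREAM S T := fun hmem => by
  obtain ⟨k, hk⟩ := exists_foolLen_violation h
  exact Nat.lt_irrefl _ (Nat.lt_of_le_of_lt (two_pow_le_space_of_SAT_mem_USTREAM hmem k) hk)

/-- **THEOREM F, headline (non-uniform).** The same for the non-uniform class `STREAM S T`.
[folklore (fooling set)] -/
theorem SAT_not_mem_STREAM_of_sublinear {S : ℕ → ℕ}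
    (h : ∃ N₀, ∀ N ≥ N₀, S N * (16 * Nat.log 2 N + 74) < N) (T : ℕ → ℕ) :
    SAT ∉ STREAM S T := fun hmem => by
  obtain ⟨k, hk⟩ := exists_foolLen_violation h
  exact Nat.lt_irrefl _ (Nat.lt_of_le_of_lt (two_pow_le_space_of_SAT_mem_STREAM hmem k) hk)

/-- **The `k = 0` instance of THEOREM E's family is a theorem**: `SAT ∉ USTREAM (N^0 + 0) (N^0 + 0)`
(indeed `SAT ∉ USTREAM 1 T` for every `T`). The summit is the conjunction over all `k`
(`pneNP_iff_SAT_not_mem_USTREAM`). [folklore] -/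
theorem SAT_not_mem_USTREAM_pow_zero (T : ℕ → ℕ) :
    SAT ∉ USTREAM (fun N => N ^ 0 + 0) T := fun hmem => by
  have := two_pow_le_space_of_SAT_mem_USTREAM hmem 1
  simp at this

end Summit.PneNP.PneNP.Theorems.SoloBlind
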